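import Literature.MathematicalPhysics.QuantumLattice.DWaveSource
import Literature.MathematicalPhysics.QuantumLattice.InfVolFermionState
import HarnessLib

/-!
# The `d`-wave pair-sourced (pinning-field) Hubbard torus: the local energy-density observable and
# the thermodynamic-limit ground-state energy density `e_src(U, μ, h)` (definitions)

Topic `Literature/MathematicalPhysics/QuantumLattice` (family `hubbard`); definitions file for the
pinning-field programme of the Hubbard cuprate cell (`hubbard-cq`, LADDER row PC-a). The pair-sourced
grand-canonical torus `A_L(U,μ,h) = H_L(1,U) − μN_L − h(Δ_d + Δ_d†)` is the tree's
`dWaveSourceTorus L U μ h` (Koma–Tasaki 1994 §1: order parameters from a symmetry-breaking source, volume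
limit FIRST). This file only NAMES three objects; every theorem about them (existence of the limit,
variational characterisation, passage of certified windows, transport in `h`) is in the companion
`DWaveSourceEnergyDensityLimit.lean`.

* `dWaveSourceWindow` — the window `thicken {0} 1 ∪ {0, ±e₁, ±e₂}` carrying the sourced energy density at
  the origin;
* `dWaveSourceEnergyObs U μ h ∈ 𝔄_W` — the local objective
  `E^src = Γ(E_Φ(1,U)) − μ (n_{0↑} + n_{0↓}) − h (Γ Φ₀ + (Γ Φ₀)†)` (`Φ₀` the `d`-wave pair word of the origin),
  literally the expression whose torus translates sum to `A_L` in the tree's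
  `sum_conj_fockTranslate_pairSourceObjective`;
* `dWaveSourceEnergyDensity U μ h = lim_L E₀(A_{L+1}(U,μ,h))/(L+1)²` (`limUnder`, as `energyDensityTT'`).

## References
* T. Koma, H. Tasaki, J. Stat. Phys. 76 (1994) 745, §1. [cite: KomaTasaki1994, §1]
* O. Bratteli, D. W. Robinson, *OAQSM 2* (1997), §6.2.4 (mean energy per unit volume).
  [cite: BratteliRobinsonII1997, §6.2.4]
-/

noncomputable section

namespace Literature.MathematicalPhysics.QuantumLattice

open _root_.Matrix Finset HubbardWave0 Literature.Probability.LatticeModels _root_.Filter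
open scoped _root_.Topology

/-- The window carrying the sourced energy density at the origin: the unit cube `thicken {0} 1`
(support of the Hubbard mean-energy observable) together with the `d`-wave pair region
`{0, ±e₁, ±e₂}` of the origin. [cite: KomaTasaki1994, §1] -/
def dWaveSourceWindow : Finset (Site 2) :=
  thicken ({0} : Finset (Site 2)) 1 ∪ pairRegion (insert (0 : Site 2) unitSteps) 0

/-- **The sourced energy-density observable at the origin**
`E^src(U,μ,h) = Γ(E_Φ(1,U)) − μ (n_{0↑} + n_{0↓}) − h (Γ Φ₀ + (Γ Φ₀)†) ∈ 𝔄_W`, `Φ₀` the `d`-wave pair word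
of the origin (`localPairAt {0,±e₁,±e₂} dWaveFormFactor 0`): the local objective whose torus translates
sum to `dWaveSourceTorus L U μ h`. [cite: KomaTasaki1994, §1] -/
def dWaveSourceEnergyObs (U μ h : ℝ) : FermionOp dWaveSourceWindow :=
  fermionEmbed (PolySite.incl (Finset.subset_union_left : thicken ({0} : Finset (Site 2)) 1 ⊆ dWaveSourceWindow))
      ((hubbardFermionInteraction 2 1 U).meanEnergyObs 1) -
    (μ : ℂ) • ∑ σ : Fin 2, nAt 0 ((Finset.subset_union_left : thicken ({0} : Finset (Site 2)) 1 ⊆ dWaveSourceWindow)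
        (subset_thicken _ _ (Finset.mem_singleton_self _))) σ -
    (h : ℂ) • (fermionEmbed (PolySite.incl
          (Finset.subset_union_right : pairRegion (insert (0 : Site 2) unitSteps) 0 ⊆ dWaveSourceWindow))
        (localPairAt (insert (0 : Site 2) unitSteps) dWaveFormFactor 0) +
      (fermionEmbed (PolySite.incl
          (Finset.subset_union_right : pairRegion (insert (0 : Site 2) unitSteps) 0 ⊆ dWaveSourceWindow))
        (localPairAt (insert (0 : Site 2) unitSteps) dWaveFormFactor 0))ᴴ)

/-- **The thermodynamic-limit ground-state energy density of the pair-sourced Hubbard torus**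
`e_src(U, μ, h) = lim_{L → ∞} E₀(A_L(U,μ,h)) / L²` (`limUnder` along the sides `L + 1`; the limit exists
for all real `U, μ, h` — `tendsto_dWaveSourceEnergyDensity` in the companion file). Koma–Tasaki take the
volume limit of the sourced ground-state energy first, then `h ↓ 0`. [cite: KomaTasaki1994, §1] -/
def dWaveSourceEnergyDensity (U μ h : ℝ) : ℝ :=
  limUnder atTop (fun L : ℕ => (dWaveSourceTorus (L + 1) U μ h).groundEnergy / (((L + 1 : ℕ) : ℝ)) ^ 2)

end Literature.MathematicalPhysics.QuantumLattice

end
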